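import Summits.SmoothPoincare4.SmoothPoincare4.Theorems.CongruenceShadowsShadowApproximationStubLayerStepZeroOneLie
import Mathlib.Tactic.NoncommRing
import HarnessLib

/-!
# Helper I (Lie side, degree four) for stub `stub_layerStepZeroTwo` of line `nilpotent-genus-class`, crux
`CongruenceShadows.ShadowApproximation` (item stmt-SmoothPoincare4-14595)

Pure algebra in the free Lie ring `L = L_ℤ(y₀, y₁, y₂)` (Mathlib's `FreeLieAlgebra ℤ (Fin 3)`), the
graded Lie ring of the free group `S₃ ⧸ N₂ = F⟨a₀, b₁, b₂⟩`, one degree above the sibling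
`…StubLayerStepZeroOneLie` (which treats `L₃`).  For the layer step `(m,c) = (0,2)` of the line
(3-step → 4-step nilpotent at genus `3`) the honest degree-three data of a third kernel form a triple
`D ∈ L₄³` subject to `⁅y₀, D₀⁆ + ⁅D₁, y₁⁆ + ⁅D₂, y₂⁆ = 0` in `L₅`.  This file supplies the linear algebra
of `L₄`:
* `L4_le_span`, `exists_coords4`: `L₄(ℤ³)` (rank `18`) is spanned by the EIGHTEEN BASIC BRACKETS, the
  right-normed `⁅y_a, ⁅y_b, ⁅y_c, y_d⁆⁆⁆` with `⁅y_b, ⁅y_c, y_d⁆⁆` one of the eight basic triple brackets of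
  the sibling file and `(a;b,c,d)` not among the six dependent ones `(1;0,0,1), (2;0,0,1), (2;0,0,2),
  (2;1,0,1), (2;1,1,2), (2;2,0,1)` (rewritten by `rel_baab`, `rel_2001`, `rel_2101`, `rel_2201`);
* Lie identities are checked UNIFORMLY through Witt's embedding `toTensor : L ↪ ℤ⟨y₀,y₁,y₂⟩`
  (`toTensor_int_injective` of the tree) and `noncomm_ring`;
* coefficient functionals in degree four (`tc4`, `tc_sum4`) and the constraint in coefficients of
  five-letter words (`coeff_constraint5`: cyclic symmetry of the coefficient tensor).
No definitions, no notations (the literal table of the eighteen brackets is written out).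
-/

set_option linter.dupNamespace false

noncomputable section

open Literature.Algebra.Lie

namespace Summit.SmoothPoincare4.SmoothPoincare4.Theorems.ShadowApproximation.NilpotentGenusClass

namespace LayerZeroTwo

open LayerZeroOne

/-! ## The six rewriting identities of `L₄(ℤ³)` -/

/-- `⁅b, ⁅a, ⁅a, b⁆⁆⁆ = ⁅a, ⁅b, ⁅a, b⁆⁆⁆` in any Lie ring (three of the six dependent brackets). [folklore] -/
theorem rel_baab (a b : FreeLieAlgebra ℤ (Fin 3)) : ⁅b, ⁅a, ⁅a, b⁆⁆⁆ = ⁅a, ⁅b, ⁅a, b⁆⁆⁆ := by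
  have h := leibniz_lie a b ⁅a, b⁆
  rw [lie_self, zero_add] at h
  exact h.symm

/-- `⁅y₂, ⁅y₀, ⁅y₀, y₁⁆⁆⁆` in the basis. [folklore] -/
theorem rel_2001 : ⁅FreeLieAlgebra.of ℤ (2 : Fin 3), ⁅FreeLieAlgebra.of ℤ (0 : Fin 3), ⁅FreeLieAlgebra.of ℤ (0 : Fin 3), FreeLieAlgebra.of ℤ (1 : Fin 3)⁆⁆⁆ = ⁅FreeLieAlgebra.of ℤ (0 : Fin 3), ⁅FreeLieAlgebra.of ℤ (0 : Fin 3), ⁅FreeLieAlgebra.of ℤ (1 : Fin 3), FreeLieAlgebra.of ℤ (2 : Fin 3)⁆⁆⁆ + 2 • ⁅FreeLieAlgebra.of ℤ (0 : Fin 3), ⁅FreeLieAlgebra.of ℤ (2 : Fin 3), ⁅FreeLieAlgebra.of ℤ (0 : Fin 3), FreeLieAlgebra.of ℤ (1 : Fin 3)⁆⁆⁆ - ⁅FreeLieAlgebra.of ℤ (1 : Fin 3), ⁅FreeLieAlgebra.of ℤ (0 : Fin 3), ⁅FreeLieAlgebra.of ℤ (0 : Fin 3), FreeLieAlgebra.of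 ℤ (2 : Fin 3)⁆⁆⁆ := by
  apply toTensor_int_injective
  simp only [LieHom.map_lie, map_add, map_sub, map_nsmul, toTensor_of, LieRing.of_associative_ring_bracket]
  noncomm_ring

/-- `⁅y₂, ⁅y₁, ⁅y₀, y₁⁆⁆⁆` in the basis. [folklore] -/
theorem rel_2101 : ⁅FreeLieAlgebra.of ℤ (2 : Fin 3), ⁅FreeLieAlgebra.of ℤ (1 : Fin 3), ⁅FreeLieAlgebra.of ℤ (0 : Fin 3), FreeLieAlgebra.of ℤ (1 : Fin 3)⁆⁆⁆ = ⁅FreeLieAlgebra.of ℤ (0 : Fin 3), ⁅FreeLieAlgebra.of ℤ (1 : Fin 3), ⁅FreeLieAlgebra.of ℤ (1 : Fin 3), FreeLieAlgebra.of ℤ (2 : Fin 3)⁆⁆⁆ - ⁅FreeLieAlgebra.of ℤ (1 : Fin 3), ⁅FreeLieAlgebra.of ℤ (0 : Fin 3), ⁅FreeLieAlgebra.of ℤ (1 : Fin 3), FreeLieAlgebra.of ℤ (2 : Fin 3)⁆⁆⁆ + ⁅FreeLieAlgebra.of ℤ (1 : Fin 3), ⁅FreeLieAlgebra.of ℤ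 (2 : Fin 3), ⁅FreeLieAlgebra.of ℤ (0 : Fin 3), FreeLieAlgebra.of ℤ (1 : Fin 3)⁆⁆⁆ := by
  apply toTensor_int_injective
  simp only [LieHom.map_lie, map_add, map_sub, toTensor_of, LieRing.of_associative_ring_bracket]
  noncomm_ring

/-- `⁅y₂, ⁅y₂, ⁅y₀, y₁⁆⁆⁆` in the basis. [folklore] -/
theorem rel_2201 : ⁅FreeLieAlgebra.of ℤ (2 : Fin 3), ⁅FreeLieAlgebra.of ℤ (2 : Fin 3), ⁅FreeLieAlgebra.of ℤ (0 : Fin 3), FreeLieAlgebra.of ℤ (1 : Fin 3)⁆⁆⁆ = ⁅FreeLieAlgebra.of ℤ (0 : Fin 3), ⁅FreeLieAlgebra.of ℤ (2 : Fin 3), ⁅FreeLieAlgebra.of ℤ (1 : Fin 3), FreeLieAlgebra.of ℤ (2 : Fin 3)⁆⁆⁆ + ⁅FreeLieAlgebra.of ℤ (1 : Fin 3), ⁅FreeLieAlgebra.of ℤ (2 : Fin 3), ⁅FreeLieAlgebra.of ℤ (0 : Fin 3), FreeLieAlgebra.of ℤ (2 : Fin 3)⁆⁆⁆ - 2 • ⁅FreeLieAlgebra.of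 ℤ (2 : Fin 3), ⁅FreeLieAlgebra.of ℤ (0 : Fin 3), ⁅FreeLieAlgebra.of ℤ (1 : Fin 3), FreeLieAlgebra.of ℤ (2 : Fin 3)⁆⁆⁆ := by
  apply toTensor_int_injective
  simp only [LieHom.map_lie, map_add, map_sub, map_nsmul, toTensor_of, LieRing.of_associative_ring_bracket]
  noncomm_ring

/-! ## `L₄` is spanned by the eighteen basic brackets -/

/-! Throughout, the EIGHTEEN BASIC BRACKETS are `⁅y_a, ⁅y_b, ⁅y_c, y_d⁆⁆⁆` for `(a;b,c,d)` in the order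
`(0;0,0,1), (0;0,0,2), (0;0,1,2), (0;1,0,1), (0;1,1,2), (0;2,0,1), (0;2,0,2), (0;2,1,2), (1;0,0,2), (1;0,1,2),
(1;1,0,1), (1;1,1,2), (1;2,0,1), (1;2,0,2), (1;2,1,2), (2;0,1,2), (2;2,0,2), (2;2,1,2)`, written as a literal
table `![…] : Fin 18 → L`. -/

/-- Every bracket of a letter with a basic triple bracket lies in the span of the eighteen. [folklore] -/
theorem lie_basic3_mem_span (a : Fin 3) (l : Fin 8) :
    ⁅FreeLieAlgebra.of ℤ a, (![⁅FreeLieAlgebra.of ℤ (0 : Fin 3), ⁅FreeLieAlgebra.of ℤ (0 : Fin 3), FreeLieAlgebra.of ℤ (1 : Fin 3)⁆⁆,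
    ⁅FreeLieAlgebra.of ℤ (0 : Fin 3), ⁅FreeLieAlgebra.of ℤ (0 : Fin 3), FreeLieAlgebra.of ℤ (2 : Fin 3)⁆⁆,
    ⁅FreeLieAlgebra.of ℤ (0 : Fin 3), ⁅FreeLieAlgebra.of ℤ (1 : Fin 3), FreeLieAlgebra.of ℤ (2 : Fin 3)⁆⁆,
    ⁅FreeLieAlgebra.of ℤ (1 : Fin 3), ⁅FreeLieAlgebra.of ℤ (0 : Fin 3), FreeLieAlgebra.of ℤ (1 : Fin 3)⁆⁆,
    ⁅FreeLieAlgebra.of ℤ (1 : Fin 3), ⁅FreeLieAlgebra.of ℤ (1 : Fin 3), FreeLieAlgebra.of ℤ (2 : Fin 3)⁆⁆,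
    ⁅FreeLieAlgebra.of ℤ (2 : Fin 3), ⁅FreeLieAlgebra.of ℤ (0 : Fin 3), FreeLieAlgebra.of ℤ (1 : Fin 3)⁆⁆,
    ⁅FreeLieAlgebra.of ℤ (2 : Fin 3), ⁅FreeLieAlgebra.of ℤ (0 : Fin 3), FreeLieAlgebra.of ℤ (2 : Fin 3)⁆⁆,
    ⁅FreeLieAlgebra.of ℤ (2 : Fin 3), ⁅FreeLieAlgebra.of ℤ (1 : Fin 3), FreeLieAlgebra.of ℤ (2 : Fin 3)⁆⁆] :
      Fin 8 → FreeLieAlgebra ℤ (Fin 3)) l⁆ ∈ Submodule.span ℤ (Set.range (![⁅FreeLieAlgebra.of ℤ (0 : Fin 3), ⁅FreeLieAlgebra.of ℤ (0 : Fin 3), ⁅FreeLieAlgebra.of ℤ (0 : Fin 3), FreeLieAlgebra.of ℤ (1 : Fin 3)⁆⁆⁆,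
    ⁅FreeLieAlgebra.of ℤ (0 : Fin 3), ⁅FreeLieAlgebra.of ℤ (0 : Fin 3), ⁅FreeLieAlgebra.of ℤ (0 : Fin 3), FreeLieAlgebra.of ℤ (2 : Fin 3)⁆⁆⁆,
    ⁅FreeLieAlgebra.of ℤ (0 : Fin 3), ⁅FreeLieAlgebra.of ℤ (0 : Fin 3), ⁅FreeLieAlgebra.of ℤ (1 : Fin 3), FreeLieAlgebra.of ℤ (2 : Fin 3)⁆⁆⁆,
    ⁅FreeLieAlgebra.of ℤ (0 : Fin 3), ⁅FreeLieAlgebra.of ℤ (1 : Fin 3), ⁅FreeLieAlgebra.of ℤ (0 : Fin 3), FreeLieAlgebra.of ℤ (1 : Fin 3)⁆⁆⁆,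
    ⁅FreeLieAlgebra.of ℤ (0 : Fin 3), ⁅FreeLieAlgebra.of ℤ (1 : Fin 3), ⁅FreeLieAlgebra.of ℤ (1 : Fin 3), FreeLieAlgebra.of ℤ (2 : Fin 3)⁆⁆⁆,
    ⁅FreeLieAlgebra.of ℤ (0 : Fin 3), ⁅FreeLieAlgebra.of ℤ (2 : Fin 3), ⁅FreeLieAlgebra.of ℤ (0 : Fin 3), FreeLieAlgebra.of ℤ (1 : Fin 3)⁆⁆⁆,
    ⁅FreeLieAlgebra.of ℤ (0 : Fin 3), ⁅FreeLieAlgebra.of ℤ (2 : Fin 3), ⁅FreeLieAlgebra.of ℤ (0 : Fin 3), FreeLieAlgebra.of ℤ (2 : Fin 3)⁆⁆⁆,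
    ⁅FreeLieAlgebra.of ℤ (0 : Fin 3), ⁅FreeLieAlgebra.of ℤ (2 : Fin 3), ⁅FreeLieAlgebra.of ℤ (1 : Fin 3), FreeLieAlgebra.of ℤ (2 : Fin 3)⁆⁆⁆,
    ⁅FreeLieAlgebra.of ℤ (1 : Fin 3), ⁅FreeLieAlgebra.of ℤ (0 : Fin 3), ⁅FreeLieAlgebra.of ℤ (0 : Fin 3), FreeLieAlgebra.of ℤ (2 : Fin 3)⁆⁆⁆,
    ⁅FreeLieAlgebra.of ℤ (1 : Fin 3), ⁅FreeLieAlgebra.of ℤ (0 : Fin 3), ⁅FreeLieAlgebra.of ℤ (1 : Fin 3), FreeLieAlgebra.of ℤ (2 : Fin 3)⁆⁆⁆,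
    ⁅FreeLieAlgebra.of ℤ (1 : Fin 3), ⁅FreeLieAlgebra.of ℤ (1 : Fin 3), ⁅FreeLieAlgebra.of ℤ (0 : Fin 3), FreeLieAlgebra.of ℤ (1 : Fin 3)⁆⁆⁆,
    ⁅FreeLieAlgebra.of ℤ (1 : Fin 3), ⁅FreeLieAlgebra.of ℤ (1 : Fin 3), ⁅FreeLieAlgebra.of ℤ (1 : Fin 3), FreeLieAlgebra.of ℤ (2 : Fin 3)⁆⁆⁆,
    ⁅FreeLieAlgebra.of ℤ (1 : Fin 3), ⁅FreeLieAlgebra.of ℤ (2 : Fin 3), ⁅FreeLieAlgebra.of ℤ (0 : Fin 3), FreeLieAlgebra.of ℤ (1 : Fin 3)⁆⁆⁆,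
    ⁅FreeLieAlgebra.of ℤ (1 : Fin 3), ⁅FreeLieAlgebra.of ℤ (2 : Fin 3), ⁅FreeLieAlgebra.of ℤ (0 : Fin 3), FreeLieAlgebra.of ℤ (2 : Fin 3)⁆⁆⁆,
    ⁅FreeLieAlgebra.of ℤ (1 : Fin 3), ⁅FreeLieAlgebra.of ℤ (2 : Fin 3), ⁅FreeLieAlgebra.of ℤ (1 : Fin 3), FreeLieAlgebra.of ℤ (2 : Fin 3)⁆⁆⁆,
    ⁅FreeLieAlgebra.of ℤ (2 : Fin 3), ⁅FreeLieAlgebra.of ℤ (0 : Fin 3), ⁅FreeLieAlgebra.of ℤ (1 : Fin 3), FreeLieAlgebra.of ℤ (2 : Fin 3)⁆⁆⁆,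
    ⁅FreeLieAlgebra.of ℤ (2 : Fin 3), ⁅FreeLieAlgebra.of ℤ (2 : Fin 3), ⁅FreeLieAlgebra.of ℤ (0 : Fin 3), FreeLieAlgebra.of ℤ (2 : Fin 3)⁆⁆⁆,
    ⁅FreeLieAlgebra.of ℤ (2 : Fin 3), ⁅FreeLieAlgebra.of ℤ (2 : Fin 3), ⁅FreeLieAlgebra.of ℤ (1 : Fin 3), FreeLieAlgebra.of ℤ (2 : Fin 3)⁆⁆⁆] :
      Fin 18 → FreeLieAlgebra ℤ (Fin 3))) := by
  set B : Fin 18 → FreeLieAlgebra ℤ (Fin 3) := (![⁅FreeLieAlgebra.of ℤ (0 : Fin 3), ⁅FreeLieAlgebra.of ℤ (0 : Fin 3), ⁅FreeLieAlgebra.of ℤ (0 : Fin 3), FreeLieAlgebra.of ℤ (1 : Fin 3)⁆⁆⁆,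
    ⁅FreeLieAlgebra.of ℤ (0 : Fin 3), ⁅FreeLieAlgebra.of ℤ (0 : Fin 3), ⁅FreeLieAlgebra.of ℤ (0 : Fin 3), FreeLieAlgebra.of ℤ (2 : Fin 3)⁆⁆⁆,
    ⁅FreeLieAlgebra.of ℤ (0 : Fin 3), ⁅FreeLieAlgebra.of ℤ (0 : Fin 3), ⁅FreeLieAlgebra.of ℤ (1 : Fin 3), FreeLieAlgebra.of ℤ (2 : Fin 3)⁆⁆⁆,
    ⁅FreeLieAlgebra.of ℤ (0 : Fin 3), ⁅FreeLieAlgebra.of ℤ (1 : Fin 3), ⁅FreeLieAlgebra.of ℤ (0 : Fin 3), FreeLieAlgebra.of ℤ (1 : Fin 3)⁆⁆⁆,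
    ⁅FreeLieAlgebra.of ℤ (0 : Fin 3), ⁅FreeLieAlgebra.of ℤ (1 : Fin 3), ⁅FreeLieAlgebra.of ℤ (1 : Fin 3), FreeLieAlgebra.of ℤ (2 : Fin 3)⁆⁆⁆,
    ⁅FreeLieAlgebra.of ℤ (0 : Fin 3), ⁅FreeLieAlgebra.of ℤ (2 : Fin 3), ⁅FreeLieAlgebra.of ℤ (0 : Fin 3), FreeLieAlgebra.of ℤ (1 : Fin 3)⁆⁆⁆,
    ⁅FreeLieAlgebra.of ℤ (0 : Fin 3), ⁅FreeLieAlgebra.of ℤ (2 : Fin 3), ⁅FreeLieAlgebra.of ℤ (0 : Fin 3), FreeLieAlgebra.of ℤ (2 : Fin 3)⁆⁆⁆,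
    ⁅FreeLieAlgebra.of ℤ (0 : Fin 3), ⁅FreeLieAlgebra.of ℤ (2 : Fin 3), ⁅FreeLieAlgebra.of ℤ (1 : Fin 3), FreeLieAlgebra.of ℤ (2 : Fin 3)⁆⁆⁆,
    ⁅FreeLieAlgebra.of ℤ (1 : Fin 3), ⁅FreeLieAlgebra.of ℤ (0 : Fin 3), ⁅FreeLieAlgebra.of ℤ (0 : Fin 3), FreeLieAlgebra.of ℤ (2 : Fin 3)⁆⁆⁆,
    ⁅FreeLieAlgebra.of ℤ (1 : Fin 3), ⁅FreeLieAlgebra.of ℤ (0 : Fin 3), ⁅FreeLieAlgebra.of ℤ (1 : Fin 3), FreeLieAlgebra.of ℤ (2 : Fin 3)⁆⁆⁆,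
    ⁅FreeLieAlgebra.of ℤ (1 : Fin 3), ⁅FreeLieAlgebra.of ℤ (1 : Fin 3), ⁅FreeLieAlgebra.of ℤ (0 : Fin 3), FreeLieAlgebra.of ℤ (1 : Fin 3)⁆⁆⁆,
    ⁅FreeLieAlgebra.of ℤ (1 : Fin 3), ⁅FreeLieAlgebra.of ℤ (1 : Fin 3), ⁅FreeLieAlgebra.of ℤ (1 : Fin 3), FreeLieAlgebra.of ℤ (2 : Fin 3)⁆⁆⁆,
    ⁅FreeLieAlgebra.of ℤ (1 : Fin 3), ⁅FreeLieAlgebra.of ℤ (2 : Fin 3), ⁅FreeLieAlgebra.of ℤ (0 : Fin 3), FreeLieAlgebra.of ℤ (1 : Fin 3)⁆⁆⁆,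
    ⁅FreeLieAlgebra.of ℤ (1 : Fin 3), ⁅FreeLieAlgebra.of ℤ (2 : Fin 3), ⁅FreeLieAlgebra.of ℤ (0 : Fin 3), FreeLieAlgebra.of ℤ (2 : Fin 3)⁆⁆⁆,
    ⁅FreeLieAlgebra.of ℤ (1 : Fin 3), ⁅FreeLieAlgebra.of ℤ (2 : Fin 3), ⁅FreeLieAlgebra.of ℤ (1 : Fin 3), FreeLieAlgebra.of ℤ (2 : Fin 3)⁆⁆⁆,
    ⁅FreeLieAlgebra.of ℤ (2 : Fin 3), ⁅FreeLieAlgebra.of ℤ (0 : Fin 3), ⁅FreeLieAlgebra.of ℤ (1 : Fin 3), FreeLieAlgebra.of ℤ (2 : Fin 3)⁆⁆⁆,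
    ⁅FreeLieAlgebra.of ℤ (2 : Fin 3), ⁅FreeLieAlgebra.of ℤ (2 : Fin 3), ⁅FreeLieAlgebra.of ℤ (0 : Fin 3), FreeLieAlgebra.of ℤ (2 : Fin 3)⁆⁆⁆,
    ⁅FreeLieAlgebra.of ℤ (2 : Fin 3), ⁅FreeLieAlgebra.of ℤ (2 : Fin 3), ⁅FreeLieAlgebra.of ℤ (1 : Fin 3), FreeLieAlgebra.of ℤ (2 : Fin 3)⁆⁆⁆] :
      Fin 18 → FreeLieAlgebra ℤ (Fin 3)) with hB
  have H : ∀ l, B l ∈ Submodule.span ℤ (Set.range B) := fun l => Submodule.subset_span ⟨l, rfl⟩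
  have H0 := H 0; have H1 := H 1; have H2 := H 2; have H3 := H 3; have H4 := H 4; have H5 := H 5
  have H6 := H 6; have H7 := H 7; have H8 := H 8; have H9 := H 9; have H10 := H 10; have H11 := H 11
  have H12 := H 12; have H13 := H 13; have H14 := H 14; have H15 := H 15; have H16 := H 16; have H17 := H 17
  simp only [hB, Matrix.cons_val] at H0 H1 H2 H3 H4 H5 H6 H7 H8 H9 H10 H11 H12 H13 H14 H15 H16 H17
  fin_cases a <;> fin_cases l <;>
    simp only [Fin.zero_eta, Fin.mk_one, Fin.reduceFinMk, Fin.isValue, Matrix.cons_val] <;>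
    first
    | assumption
    | (rw [rel_baab]; assumption)
    | (rw [rel_2001]; exact Submodule.sub_mem _ (Submodule.add_mem _ H2 (Submodule.smul_mem _ _ H5)) H8)
    | (rw [rel_2101]; exact Submodule.add_mem _ (Submodule.sub_mem _ H4 H9) H12)
    | (rw [rel_2201]; exact Submodule.sub_mem _ (Submodule.add_mem _ H7 H13) (Submodule.smul_mem _ _ H15))

/-- **`L₄` is spanned by the eighteen basic brackets.** [folklore] -/
theorem L4_le_span : wordGrade ℤ (FreeLieAlgebra.of ℤ : Fin 3 → FreeLieAlgebra ℤ (Fin 3)) 4 ≤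
    Submodule.span ℤ (Set.range (![⁅FreeLieAlgebra.of ℤ (0 : Fin 3), ⁅FreeLieAlgebra.of ℤ (0 : Fin 3), ⁅FreeLieAlgebra.of ℤ (0 : Fin 3), FreeLieAlgebra.of ℤ (1 : Fin 3)⁆⁆⁆,
    ⁅FreeLieAlgebra.of ℤ (0 : Fin 3), ⁅FreeLieAlgebra.of ℤ (0 : Fin 3), ⁅FreeLieAlgebra.of ℤ (0 : Fin 3), FreeLieAlgebra.of ℤ (2 : Fin 3)⁆⁆⁆,
    ⁅FreeLieAlgebra.of ℤ (0 : Fin 3), ⁅FreeLieAlgebra.of ℤ (0 : Fin 3), ⁅FreeLieAlgebra.of ℤ (1 : Fin 3), FreeLieAlgebra.of ℤ (2 : Fin 3)⁆⁆⁆,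
    ⁅FreeLieAlgebra.of ℤ (0 : Fin 3), ⁅FreeLieAlgebra.of ℤ (1 : Fin 3), ⁅FreeLieAlgebra.of ℤ (0 : Fin 3), FreeLieAlgebra.of ℤ (1 : Fin 3)⁆⁆⁆,
    ⁅FreeLieAlgebra.of ℤ (0 : Fin 3), ⁅FreeLieAlgebra.of ℤ (1 : Fin 3), ⁅FreeLieAlgebra.of ℤ (1 : Fin 3), FreeLieAlgebra.of ℤ (2 : Fin 3)⁆⁆⁆,
    ⁅FreeLieAlgebra.of ℤ (0 : Fin 3), ⁅FreeLieAlgebra.of ℤ (2 : Fin 3), ⁅FreeLieAlgebra.of ℤ (0 : Fin 3), FreeLieAlgebra.of ℤ (1 : Fin 3)⁆⁆⁆,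
    ⁅FreeLieAlgebra.of ℤ (0 : Fin 3), ⁅FreeLieAlgebra.of ℤ (2 : Fin 3), ⁅FreeLieAlgebra.of ℤ (0 : Fin 3), FreeLieAlgebra.of ℤ (2 : Fin 3)⁆⁆⁆,
    ⁅FreeLieAlgebra.of ℤ (0 : Fin 3), ⁅FreeLieAlgebra.of ℤ (2 : Fin 3), ⁅FreeLieAlgebra.of ℤ (1 : Fin 3), FreeLieAlgebra.of ℤ (2 : Fin 3)⁆⁆⁆,
    ⁅FreeLieAlgebra.of ℤ (1 : Fin 3), ⁅FreeLieAlgebra.of ℤ (0 : Fin 3), ⁅FreeLieAlgebra.of ℤ (0 : Fin 3), FreeLieAlgebra.of ℤ (2 : Fin 3)⁆⁆⁆,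
    ⁅FreeLieAlgebra.of ℤ (1 : Fin 3), ⁅FreeLieAlgebra.of ℤ (0 : Fin 3), ⁅FreeLieAlgebra.of ℤ (1 : Fin 3), FreeLieAlgebra.of ℤ (2 : Fin 3)⁆⁆⁆,
    ⁅FreeLieAlgebra.of ℤ (1 : Fin 3), ⁅FreeLieAlgebra.of ℤ (1 : Fin 3), ⁅FreeLieAlgebra.of ℤ (0 : Fin 3), FreeLieAlgebra.of ℤ (1 : Fin 3)⁆⁆⁆,
    ⁅FreeLieAlgebra.of ℤ (1 : Fin 3), ⁅FreeLieAlgebra.of ℤ (1 : Fin 3), ⁅FreeLieAlgebra.of ℤ (1 : Fin 3), FreeLieAlgebra.of ℤ (2 : Fin 3)⁆⁆⁆,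
    ⁅FreeLieAlgebra.of ℤ (1 : Fin 3), ⁅FreeLieAlgebra.of ℤ (2 : Fin 3), ⁅FreeLieAlgebra.of ℤ (0 : Fin 3), FreeLieAlgebra.of ℤ (1 : Fin 3)⁆⁆⁆,
    ⁅FreeLieAlgebra.of ℤ (1 : Fin 3), ⁅FreeLieAlgebra.of ℤ (2 : Fin 3), ⁅FreeLieAlgebra.of ℤ (0 : Fin 3), FreeLieAlgebra.of ℤ (2 : Fin 3)⁆⁆⁆,
    ⁅FreeLieAlgebra.of ℤ (1 : Fin 3), ⁅FreeLieAlgebra.of ℤ (2 : Fin 3), ⁅FreeLieAlgebra.of ℤ (1 : Fin 3), FreeLieAlgebra.of ℤ (2 : Fin 3)⁆⁆⁆,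
    ⁅FreeLieAlgebra.of ℤ (2 : Fin 3), ⁅FreeLieAlgebra.of ℤ (0 : Fin 3), ⁅FreeLieAlgebra.of ℤ (1 : Fin 3), FreeLieAlgebra.of ℤ (2 : Fin 3)⁆⁆⁆,
    ⁅FreeLieAlgebra.of ℤ (2 : Fin 3), ⁅FreeLieAlgebra.of ℤ (2 : Fin 3), ⁅FreeLieAlgebra.of ℤ (0 : Fin 3), FreeLieAlgebra.of ℤ (2 : Fin 3)⁆⁆⁆,
    ⁅FreeLieAlgebra.of ℤ (2 : Fin 3), ⁅FreeLieAlgebra.of ℤ (2 : Fin 3), ⁅FreeLieAlgebra.of ℤ (1 : Fin 3), FreeLieAlgebra.of ℤ (2 : Fin 3)⁆⁆⁆] :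
      Fin 18 → FreeLieAlgebra ℤ (Fin 3))) := by
  refine (wordGrade_succ_succ_le_span_lie _ 2).trans (Submodule.span_le.2 ?_)
  rintro _ ⟨x, u, hu, rfl⟩
  have hu' := L3_le_span hu
  refine Submodule.span_induction (p := fun u _ => ⁅FreeLieAlgebra.of ℤ x, u⁆ ∈ Submodule.span ℤ (Set.range (![⁅FreeLieAlgebra.of ℤ (0 : Fin 3), ⁅FreeLieAlgebra.of ℤ (0 : Fin 3), ⁅FreeLieAlgebra.of ℤ (0 : Fin 3), FreeLieAlgebra.of ℤ (1 : Fin 3)⁆⁆⁆,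
    ⁅FreeLieAlgebra.of ℤ (0 : Fin 3), ⁅FreeLieAlgebra.of ℤ (0 : Fin 3), ⁅FreeLieAlgebra.of ℤ (0 : Fin 3), FreeLieAlgebra.of ℤ (2 : Fin 3)⁆⁆⁆,
    ⁅FreeLieAlgebra.of ℤ (0 : Fin 3), ⁅FreeLieAlgebra.of ℤ (0 : Fin 3), ⁅FreeLieAlgebra.of ℤ (1 : Fin 3), FreeLieAlgebra.of ℤ (2 : Fin 3)⁆⁆⁆,
    ⁅FreeLieAlgebra.of ℤ (0 : Fin 3), ⁅FreeLieAlgebra.of ℤ (1 : Fin 3), ⁅FreeLieAlgebra.of ℤ (0 : Fin 3), FreeLieAlgebra.of ℤ (1 : Fin 3)⁆⁆⁆,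
    ⁅FreeLieAlgebra.of ℤ (0 : Fin 3), ⁅FreeLieAlgebra.of ℤ (1 : Fin 3), ⁅FreeLieAlgebra.of ℤ (1 : Fin 3), FreeLieAlgebra.of ℤ (2 : Fin 3)⁆⁆⁆,
    ⁅FreeLieAlgebra.of ℤ (0 : Fin 3), ⁅FreeLieAlgebra.of ℤ (2 : Fin 3), ⁅FreeLieAlgebra.of ℤ (0 : Fin 3), FreeLieAlgebra.of ℤ (1 : Fin 3)⁆⁆⁆,
    ⁅FreeLieAlgebra.of ℤ (0 : Fin 3), ⁅FreeLieAlgebra.of ℤ (2 : Fin 3), ⁅FreeLieAlgebra.of ℤ (0 : Fin 3), FreeLieAlgebra.of ℤ (2 : Fin 3)⁆⁆⁆,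
    ⁅FreeLieAlgebra.of ℤ (0 : Fin 3), ⁅FreeLieAlgebra.of ℤ (2 : Fin 3), ⁅FreeLieAlgebra.of ℤ (1 : Fin 3), FreeLieAlgebra.of ℤ (2 : Fin 3)⁆⁆⁆,
    ⁅FreeLieAlgebra.of ℤ (1 : Fin 3), ⁅FreeLieAlgebra.of ℤ (0 : Fin 3), ⁅FreeLieAlgebra.of ℤ (0 : Fin 3), FreeLieAlgebra.of ℤ (2 : Fin 3)⁆⁆⁆,
    ⁅FreeLieAlgebra.of ℤ (1 : Fin 3), ⁅FreeLieAlgebra.of ℤ (0 : Fin 3), ⁅FreeLieAlgebra.of ℤ (1 : Fin 3), FreeLieAlgebra.of ℤ (2 : Fin 3)⁆⁆⁆,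
    ⁅FreeLieAlgebra.of ℤ (1 : Fin 3), ⁅FreeLieAlgebra.of ℤ (1 : Fin 3), ⁅FreeLieAlgebra.of ℤ (0 : Fin 3), FreeLieAlgebra.of ℤ (1 : Fin 3)⁆⁆⁆,
    ⁅FreeLieAlgebra.of ℤ (1 : Fin 3), ⁅FreeLieAlgebra.of ℤ (1 : Fin 3), ⁅FreeLieAlgebra.of ℤ (1 : Fin 3), FreeLieAlgebra.of ℤ (2 : Fin 3)⁆⁆⁆,
    ⁅FreeLieAlgebra.of ℤ (1 : Fin 3), ⁅FreeLieAlgebra.of ℤ (2 : Fin 3), ⁅FreeLieAlgebra.of ℤ (0 : Fin 3), FreeLieAlgebra.of ℤ (1 : Fin 3)⁆⁆⁆,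
    ⁅FreeLieAlgebra.of ℤ (1 : Fin 3), ⁅FreeLieAlgebra.of ℤ (2 : Fin 3), ⁅FreeLieAlgebra.of ℤ (0 : Fin 3), FreeLieAlgebra.of ℤ (2 : Fin 3)⁆⁆⁆,
    ⁅FreeLieAlgebra.of ℤ (1 : Fin 3), ⁅FreeLieAlgebra.of ℤ (2 : Fin 3), ⁅FreeLieAlgebra.of ℤ (1 : Fin 3), FreeLieAlgebra.of ℤ (2 : Fin 3)⁆⁆⁆,
    ⁅FreeLieAlgebra.of ℤ (2 : Fin 3), ⁅FreeLieAlgebra.of ℤ (0 : Fin 3), ⁅FreeLieAlgebra.of ℤ (1 : Fin 3), FreeLieAlgebra.of ℤ (2 : Fin 3)⁆⁆⁆,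
    ⁅FreeLieAlgebra.of ℤ (2 : Fin 3), ⁅FreeLieAlgebra.of ℤ (2 : Fin 3), ⁅FreeLieAlgebra.of ℤ (0 : Fin 3), FreeLieAlgebra.of ℤ (2 : Fin 3)⁆⁆⁆,
    ⁅FreeLieAlgebra.of ℤ (2 : Fin 3), ⁅FreeLieAlgebra.of ℤ (2 : Fin 3), ⁅FreeLieAlgebra.of ℤ (1 : Fin 3), FreeLieAlgebra.of ℤ (2 : Fin 3)⁆⁆⁆] :
      Fin 18 → FreeLieAlgebra ℤ (Fin 3))))
    ?_ ?_ ?_ ?_ hu'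
  · rintro _ ⟨l, rfl⟩
    exact lie_basic3_mem_span x l
  · rw [lie_zero]; exact Submodule.zero_mem _
  · intro v w _ _ hv hw
    rw [lie_add]; exact Submodule.add_mem _ hv hw
  · intro n v _ hv
    rw [lie_smul]; exact Submodule.smul_mem _ n hv

/-- Coordinates: every element of `L₄` is an integer combination of the eighteen basic brackets. [folklore] -/
theorem exists_coords4 {u : FreeLieAlgebra ℤ (Fin 3)}
    (hu : u ∈ wordGrade ℤ (FreeLieAlgebra.of ℤ : Fin 3 → FreeLieAlgebra ℤ (Fin 3)) 4) :
    ∃ c : Fin 18 → ℤ, u = ∑ l, c l • (![⁅FreeLieAlgebra.of ℤ (0 : Fin 3), ⁅FreeLieAlgebra.of ℤ (0 : Fin 3), ⁅FreeLieAlgebra.of ℤ (0 : Fin 3), FreeLieAlgebra.of ℤ (1 : Fin 3)⁆⁆⁆,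
    ⁅FreeLieAlgebra.of ℤ (0 : Fin 3), ⁅FreeLieAlgebra.of ℤ (0 : Fin 3), ⁅FreeLieAlgebra.of ℤ (0 : Fin 3), FreeLieAlgebra.of ℤ (2 : Fin 3)⁆⁆⁆,
    ⁅FreeLieAlgebra.of ℤ (0 : Fin 3), ⁅FreeLieAlgebra.of ℤ (0 : Fin 3), ⁅FreeLieAlgebra.of ℤ (1 : Fin 3), FreeLieAlgebra.of ℤ (2 : Fin 3)⁆⁆⁆,
    ⁅FreeLieAlgebra.of ℤ (0 : Fin 3), ⁅FreeLieAlgebra.of ℤ (1 : Fin 3), ⁅FreeLieAlgebra.of ℤ (0 : Fin 3), FreeLieAlgebra.of ℤ (1 : Fin 3)⁆⁆⁆,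
    ⁅FreeLieAlgebra.of ℤ (0 : Fin 3), ⁅FreeLieAlgebra.of ℤ (1 : Fin 3), ⁅FreeLieAlgebra.of ℤ (1 : Fin 3), FreeLieAlgebra.of ℤ (2 : Fin 3)⁆⁆⁆,
    ⁅FreeLieAlgebra.of ℤ (0 : Fin 3), ⁅FreeLieAlgebra.of ℤ (2 : Fin 3), ⁅FreeLieAlgebra.of ℤ (0 : Fin 3), FreeLieAlgebra.of ℤ (1 : Fin 3)⁆⁆⁆,
    ⁅FreeLieAlgebra.of ℤ (0 : Fin 3), ⁅FreeLieAlgebra.of ℤ (2 : Fin 3), ⁅FreeLieAlgebra.of ℤ (0 : Fin 3), FreeLieAlgebra.of ℤ (2 : Fin 3)⁆⁆⁆,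
    ⁅FreeLieAlgebra.of ℤ (0 : Fin 3), ⁅FreeLieAlgebra.of ℤ (2 : Fin 3), ⁅FreeLieAlgebra.of ℤ (1 : Fin 3), FreeLieAlgebra.of ℤ (2 : Fin 3)⁆⁆⁆,
    ⁅FreeLieAlgebra.of ℤ (1 : Fin 3), ⁅FreeLieAlgebra.of ℤ (0 : Fin 3), ⁅FreeLieAlgebra.of ℤ (0 : Fin 3), FreeLieAlgebra.of ℤ (2 : Fin 3)⁆⁆⁆,
    ⁅FreeLieAlgebra.of ℤ (1 : Fin 3), ⁅FreeLieAlgebra.of ℤ (0 : Fin 3), ⁅FreeLieAlgebra.of ℤ (1 : Fin 3), FreeLieAlgebra.of ℤ (2 : Fin 3)⁆⁆⁆,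
    ⁅FreeLieAlgebra.of ℤ (1 : Fin 3), ⁅FreeLieAlgebra.of ℤ (1 : Fin 3), ⁅FreeLieAlgebra.of ℤ (0 : Fin 3), FreeLieAlgebra.of ℤ (1 : Fin 3)⁆⁆⁆,
    ⁅FreeLieAlgebra.of ℤ (1 : Fin 3), ⁅FreeLieAlgebra.of ℤ (1 : Fin 3), ⁅FreeLieAlgebra.of ℤ (1 : Fin 3), FreeLieAlgebra.of ℤ (2 : Fin 3)⁆⁆⁆,
    ⁅FreeLieAlgebra.of ℤ (1 : Fin 3), ⁅FreeLieAlgebra.of ℤ (2 : Fin 3), ⁅FreeLieAlgebra.of ℤ (0 : Fin 3), FreeLieAlgebra.of ℤ (1 : Fin 3)⁆⁆⁆,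
    ⁅FreeLieAlgebra.of ℤ (1 : Fin 3), ⁅FreeLieAlgebra.of ℤ (2 : Fin 3), ⁅FreeLieAlgebra.of ℤ (0 : Fin 3), FreeLieAlgebra.of ℤ (2 : Fin 3)⁆⁆⁆,
    ⁅FreeLieAlgebra.of ℤ (1 : Fin 3), ⁅FreeLieAlgebra.of ℤ (2 : Fin 3), ⁅FreeLieAlgebra.of ℤ (1 : Fin 3), FreeLieAlgebra.of ℤ (2 : Fin 3)⁆⁆⁆,
    ⁅FreeLieAlgebra.of ℤ (2 : Fin 3), ⁅FreeLieAlgebra.of ℤ (0 : Fin 3), ⁅FreeLieAlgebra.of ℤ (1 : Fin 3), FreeLieAlgebra.of ℤ (2 : Fin 3)⁆⁆⁆,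
    ⁅FreeLieAlgebra.of ℤ (2 : Fin 3), ⁅FreeLieAlgebra.of ℤ (2 : Fin 3), ⁅FreeLieAlgebra.of ℤ (0 : Fin 3), FreeLieAlgebra.of ℤ (2 : Fin 3)⁆⁆⁆,
    ⁅FreeLieAlgebra.of ℤ (2 : Fin 3), ⁅FreeLieAlgebra.of ℤ (2 : Fin 3), ⁅FreeLieAlgebra.of ℤ (1 : Fin 3), FreeLieAlgebra.of ℤ (2 : Fin 3)⁆⁆⁆] :
      Fin 18 → FreeLieAlgebra ℤ (Fin 3)) l := by
  obtain ⟨c, hc⟩ := (Submodule.mem_span_range_iff_exists_fun ℤ).1 (L4_le_span hu)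
  exact ⟨c, hc.symm⟩

/-! ## Coefficient functionals in degree four -/

/-- **Coefficients of a right-normed quadruple bracket** `⁅y_a, ⁅y_b, ⁅y_c, y_d⁆⁆⁆` at the word
`y_p y_q y_r y_s` (eight signed terms). [folklore] -/
theorem tc4 (a b c d p q r s : Fin 3) :
    ((toTensor ℤ (Fin 3) (⁅FreeLieAlgebra.of ℤ a, ⁅FreeLieAlgebra.of ℤ b, ⁅FreeLieAlgebra.of ℤ c, FreeLieAlgebra.of ℤ d⁆⁆⁆)).coeff
      (FreeMonoid.of p * (FreeMonoid.of q * (FreeMonoid.of r * FreeMonoid.of s)))) =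
      ((if a = p ∧ b = q ∧ c = r ∧ d = s then 1 else 0) - (if a = p ∧ b = q ∧ d = r ∧ c = s then 1 else 0)
        - ((if a = p ∧ c = q ∧ d = r ∧ b = s then 1 else 0) - (if a = p ∧ d = q ∧ c = r ∧ b = s then 1 else 0)))
      - ((if b = p ∧ c = q ∧ d = r ∧ a = s then 1 else 0) - (if b = p ∧ d = q ∧ c = r ∧ a = s then 1 else 0)
        - ((if c = p ∧ d = q ∧ b = r ∧ a = s then 1 else 0) - (if d = p ∧ c = q ∧ b = r ∧ a = s then 1 else 0))) := by
  classical
  simp only [LieHom.map_lie, toTensor_of, LieRing.of_associative_ring_bracket, mul_sub, sub_mul,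
    mul_assoc, MonoidAlgebra.single_mul_single, mul_one, MonoidAlgebra.coeff_sub,
    MonoidAlgebra.coeff_single, Finsupp.sub_apply, Finsupp.single_apply, of_mul_eq_of_mul_iff,
    of_eq_of_iff]

/-- Coefficients of a combination of the eighteen basic brackets. [folklore] -/
theorem tc_sum4 (c : Fin 18 → ℤ) (w : FreeMonoid (Fin 3)) :
    ((toTensor ℤ (Fin 3) (∑ l, c l • (![⁅FreeLieAlgebra.of ℤ (0 : Fin 3), ⁅FreeLieAlgebra.of ℤ (0 : Fin 3), ⁅FreeLieAlgebra.of ℤ (0 : Fin 3), FreeLieAlgebra.of ℤ (1 : Fin 3)⁆⁆⁆,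
    ⁅FreeLieAlgebra.of ℤ (0 : Fin 3), ⁅FreeLieAlgebra.of ℤ (0 : Fin 3), ⁅FreeLieAlgebra.of ℤ (0 : Fin 3), FreeLieAlgebra.of ℤ (2 : Fin 3)⁆⁆⁆,
    ⁅FreeLieAlgebra.of ℤ (0 : Fin 3), ⁅FreeLieAlgebra.of ℤ (0 : Fin 3), ⁅FreeLieAlgebra.of ℤ (1 : Fin 3), FreeLieAlgebra.of ℤ (2 : Fin 3)⁆⁆⁆,
    ⁅FreeLieAlgebra.of ℤ (0 : Fin 3), ⁅FreeLieAlgebra.of ℤ (1 : Fin 3), ⁅FreeLieAlgebra.of ℤ (0 : Fin 3), FreeLieAlgebra.of ℤ (1 : Fin 3)⁆⁆⁆,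
    ⁅FreeLieAlgebra.of ℤ (0 : Fin 3), ⁅FreeLieAlgebra.of ℤ (1 : Fin 3), ⁅FreeLieAlgebra.of ℤ (1 : Fin 3), FreeLieAlgebra.of ℤ (2 : Fin 3)⁆⁆⁆,
    ⁅FreeLieAlgebra.of ℤ (0 : Fin 3), ⁅FreeLieAlgebra.of ℤ (2 : Fin 3), ⁅FreeLieAlgebra.of ℤ (0 : Fin 3), FreeLieAlgebra.of ℤ (1 : Fin 3)⁆⁆⁆,
    ⁅FreeLieAlgebra.of ℤ (0 : Fin 3), ⁅FreeLieAlgebra.of ℤ (2 : Fin 3), ⁅FreeLieAlgebra.of ℤ (0 : Fin 3), FreeLieAlgebra.of ℤ (2 : Fin 3)⁆⁆⁆,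
    ⁅FreeLieAlgebra.of ℤ (0 : Fin 3), ⁅FreeLieAlgebra.of ℤ (2 : Fin 3), ⁅FreeLieAlgebra.of ℤ (1 : Fin 3), FreeLieAlgebra.of ℤ (2 : Fin 3)⁆⁆⁆,
    ⁅FreeLieAlgebra.of ℤ (1 : Fin 3), ⁅FreeLieAlgebra.of ℤ (0 : Fin 3), ⁅FreeLieAlgebra.of ℤ (0 : Fin 3), FreeLieAlgebra.of ℤ (2 : Fin 3)⁆⁆⁆,
    ⁅FreeLieAlgebra.of ℤ (1 : Fin 3), ⁅FreeLieAlgebra.of ℤ (0 : Fin 3), ⁅FreeLieAlgebra.of ℤ (1 : Fin 3), FreeLieAlgebra.of ℤ (2 : Fin 3)⁆⁆⁆,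
    ⁅FreeLieAlgebra.of ℤ (1 : Fin 3), ⁅FreeLieAlgebra.of ℤ (1 : Fin 3), ⁅FreeLieAlgebra.of ℤ (0 : Fin 3), FreeLieAlgebra.of ℤ (1 : Fin 3)⁆⁆⁆,
    ⁅FreeLieAlgebra.of ℤ (1 : Fin 3), ⁅FreeLieAlgebra.of ℤ (1 : Fin 3), ⁅FreeLieAlgebra.of ℤ (1 : Fin 3), FreeLieAlgebra.of ℤ (2 : Fin 3)⁆⁆⁆,
    ⁅FreeLieAlgebra.of ℤ (1 : Fin 3), ⁅FreeLieAlgebra.of ℤ (2 : Fin 3), ⁅FreeLieAlgebra.of ℤ (0 : Fin 3), FreeLieAlgebra.of ℤ (1 : Fin 3)⁆⁆⁆,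
    ⁅FreeLieAlgebra.of ℤ (1 : Fin 3), ⁅FreeLieAlgebra.of ℤ (2 : Fin 3), ⁅FreeLieAlgebra.of ℤ (0 : Fin 3), FreeLieAlgebra.of ℤ (2 : Fin 3)⁆⁆⁆,
    ⁅FreeLieAlgebra.of ℤ (1 : Fin 3), ⁅FreeLieAlgebra.of ℤ (2 : Fin 3), ⁅FreeLieAlgebra.of ℤ (1 : Fin 3), FreeLieAlgebra.of ℤ (2 : Fin 3)⁆⁆⁆,
    ⁅FreeLieAlgebra.of ℤ (2 : Fin 3), ⁅FreeLieAlgebra.of ℤ (0 : Fin 3), ⁅FreeLieAlgebra.of ℤ (1 : Fin 3), FreeLieAlgebra.of ℤ (2 : Fin 3)⁆⁆⁆,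
    ⁅FreeLieAlgebra.of ℤ (2 : Fin 3), ⁅FreeLieAlgebra.of ℤ (2 : Fin 3), ⁅FreeLieAlgebra.of ℤ (0 : Fin 3), FreeLieAlgebra.of ℤ (2 : Fin 3)⁆⁆⁆,
    ⁅FreeLieAlgebra.of ℤ (2 : Fin 3), ⁅FreeLieAlgebra.of ℤ (2 : Fin 3), ⁅FreeLieAlgebra.of ℤ (1 : Fin 3), FreeLieAlgebra.of ℤ (2 : Fin 3)⁆⁆⁆] :
      Fin 18 → FreeLieAlgebra ℤ (Fin 3)) l)).coeff w) = ∑ l, c l * ((toTensor ℤ (Fin 3) ((![⁅FreeLieAlgebra.of ℤ (0 : Fin 3), ⁅FreeLieAlgebra.of ℤ (0 : Fin 3), ⁅FreeLieAlgebra.of ℤ (0 : Fin 3), FreeLieAlgebra.of ℤ (1 : Fin 3)⁆⁆⁆,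
    ⁅FreeLieAlgebra.of ℤ (0 : Fin 3), ⁅FreeLieAlgebra.of ℤ (0 : Fin 3), ⁅FreeLieAlgebra.of ℤ (0 : Fin 3), FreeLieAlgebra.of ℤ (2 : Fin 3)⁆⁆⁆,
    ⁅FreeLieAlgebra.of ℤ (0 : Fin 3), ⁅FreeLieAlgebra.of ℤ (0 : Fin 3), ⁅FreeLieAlgebra.of ℤ (1 : Fin 3), FreeLieAlgebra.of ℤ (2 : Fin 3)⁆⁆⁆,
    ⁅FreeLieAlgebra.of ℤ (0 : Fin 3), ⁅FreeLieAlgebra.of ℤ (1 : Fin 3), ⁅FreeLieAlgebra.of ℤ (0 : Fin 3), FreeLieAlgebra.of ℤ (1 : Fin 3)⁆⁆⁆,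
    ⁅FreeLieAlgebra.of ℤ (0 : Fin 3), ⁅FreeLieAlgebra.of ℤ (1 : Fin 3), ⁅FreeLieAlgebra.of ℤ (1 : Fin 3), FreeLieAlgebra.of ℤ (2 : Fin 3)⁆⁆⁆,
    ⁅FreeLieAlgebra.of ℤ (0 : Fin 3), ⁅FreeLieAlgebra.of ℤ (2 : Fin 3), ⁅FreeLieAlgebra.of ℤ (0 : Fin 3), FreeLieAlgebra.of ℤ (1 : Fin 3)⁆⁆⁆,
    ⁅FreeLieAlgebra.of ℤ (0 : Fin 3), ⁅FreeLieAlgebra.of ℤ (2 : Fin 3), ⁅FreeLieAlgebra.of ℤ (0 : Fin 3), FreeLieAlgebra.of ℤ (2 : Fin 3)⁆⁆⁆,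
    ⁅FreeLieAlgebra.of ℤ (0 : Fin 3), ⁅FreeLieAlgebra.of ℤ (2 : Fin 3), ⁅FreeLieAlgebra.of ℤ (1 : Fin 3), FreeLieAlgebra.of ℤ (2 : Fin 3)⁆⁆⁆,
    ⁅FreeLieAlgebra.of ℤ (1 : Fin 3), ⁅FreeLieAlgebra.of ℤ (0 : Fin 3), ⁅FreeLieAlgebra.of ℤ (0 : Fin 3), FreeLieAlgebra.of ℤ (2 : Fin 3)⁆⁆⁆,
    ⁅FreeLieAlgebra.of ℤ (1 : Fin 3), ⁅FreeLieAlgebra.of ℤ (0 : Fin 3), ⁅FreeLieAlgebra.of ℤ (1 : Fin 3), FreeLieAlgebra.of ℤ (2 : Fin 3)⁆⁆⁆,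
    ⁅FreeLieAlgebra.of ℤ (1 : Fin 3), ⁅FreeLieAlgebra.of ℤ (1 : Fin 3), ⁅FreeLieAlgebra.of ℤ (0 : Fin 3), FreeLieAlgebra.of ℤ (1 : Fin 3)⁆⁆⁆,
    ⁅FreeLieAlgebra.of ℤ (1 : Fin 3), ⁅FreeLieAlgebra.of ℤ (1 : Fin 3), ⁅FreeLieAlgebra.of ℤ (1 : Fin 3), FreeLieAlgebra.of ℤ (2 : Fin 3)⁆⁆⁆,
    ⁅FreeLieAlgebra.of ℤ (1 : Fin 3), ⁅FreeLieAlgebra.of ℤ (2 : Fin 3), ⁅FreeLieAlgebra.of ℤ (0 : Fin 3), FreeLieAlgebra.of ℤ (1 : Fin 3)⁆⁆⁆,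
    ⁅FreeLieAlgebra.of ℤ (1 : Fin 3), ⁅FreeLieAlgebra.of ℤ (2 : Fin 3), ⁅FreeLieAlgebra.of ℤ (0 : Fin 3), FreeLieAlgebra.of ℤ (2 : Fin 3)⁆⁆⁆,
    ⁅FreeLieAlgebra.of ℤ (1 : Fin 3), ⁅FreeLieAlgebra.of ℤ (2 : Fin 3), ⁅FreeLieAlgebra.of ℤ (1 : Fin 3), FreeLieAlgebra.of ℤ (2 : Fin 3)⁆⁆⁆,
    ⁅FreeLieAlgebra.of ℤ (2 : Fin 3), ⁅FreeLieAlgebra.of ℤ (0 : Fin 3), ⁅FreeLieAlgebra.of ℤ (1 : Fin 3), FreeLieAlgebra.of ℤ (2 : Fin 3)⁆⁆⁆,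
    ⁅FreeLieAlgebra.of ℤ (2 : Fin 3), ⁅FreeLieAlgebra.of ℤ (2 : Fin 3), ⁅FreeLieAlgebra.of ℤ (0 : Fin 3), FreeLieAlgebra.of ℤ (2 : Fin 3)⁆⁆⁆,
    ⁅FreeLieAlgebra.of ℤ (2 : Fin 3), ⁅FreeLieAlgebra.of ℤ (2 : Fin 3), ⁅FreeLieAlgebra.of ℤ (1 : Fin 3), FreeLieAlgebra.of ℤ (2 : Fin 3)⁆⁆⁆] :
      Fin 18 → FreeLieAlgebra ℤ (Fin 3)) l)).coeff w) := by
  simp only [map_sum, map_zsmul, MonoidAlgebra.coeff_sum, MonoidAlgebra.coeff_smul,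
    Finsupp.finsetSum_apply, Finsupp.smul_apply, smul_eq_mul]

/-! ## The constraint in coefficients of five-letter words -/

/-- Right multiplication by a letter shifts coefficients of five-letter words:
`coeff_{y_p y_q y_r y_s y_u}(t · y_i) = [i = u] coeff_{y_p y_q y_r y_s}(t)`. [folklore] -/
theorem coeff_mul_of5 (i p q r s u : Fin 3) (t : MonoidAlgebra ℤ (FreeMonoid (Fin 3))) :
    (t * MonoidAlgebra.single (FreeMonoid.of i) 1).coeff
        (FreeMonoid.of p * (FreeMonoid.of q * (FreeMonoid.of r * (FreeMonoid.of s * FreeMonoid.of u)))) =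
      if i = u then t.coeff (FreeMonoid.of p * (FreeMonoid.of q * (FreeMonoid.of r * FreeMonoid.of s))) else 0 := by
  have e : FreeMonoid.of p * (FreeMonoid.of q * (FreeMonoid.of r * (FreeMonoid.of s * FreeMonoid.of u))) =
      (FreeMonoid.of p * (FreeMonoid.of q * (FreeMonoid.of r * FreeMonoid.of s))) * FreeMonoid.of u := by
    simp only [mul_assoc]
  rw [e]
  split_ifs with h
  · subst h
    rw [MonoidAlgebra.coeff_mul_single_eq_coeff_mul _ fun m _ => ?_, mul_one]
    rw [mul_of_eq_mul_of_iff]; exact ⟨fun h => h.1, fun h => ⟨h, rfl⟩⟩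
  · exact MonoidAlgebra.coeff_mul_single_of_forall_mul_ne _ _ fun d hd =>
      h ((mul_of_eq_mul_of_iff _ _ _ _).1 hd).2

/-- **The constraint in coefficients (cyclic symmetry), degree five.** If
`⁅y₀, D₀⁆ + ⁅D₁, y₁⁆ + ⁅D₂, y₂⁆ = 0` then for every word `y_p y_q y_r y_s y_u` the six shifted coefficients
cancel. [folklore] -/
theorem coeff_constraint5 (D : Fin 3 → FreeLieAlgebra ℤ (Fin 3))
    (hC : ⁅FreeLieAlgebra.of ℤ (0 : Fin 3), D 0⁆ + ⁅D 1, FreeLieAlgebra.of ℤ (1 : Fin 3)⁆ + ⁅D 2, FreeLieAlgebra.of ℤ (2 : Fin 3)⁆ = 0) (p q r s u : Fin 3) :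
    ((if (0 : Fin 3) = p then ((toTensor ℤ (Fin 3) (D 0)).coeff (FreeMonoid.of q * (FreeMonoid.of r * (FreeMonoid.of s * FreeMonoid.of u)))) else 0) -
      (if (0 : Fin 3) = u then ((toTensor ℤ (Fin 3) (D 0)).coeff (FreeMonoid.of p * (FreeMonoid.of q * (FreeMonoid.of r * FreeMonoid.of s)))) else 0)) +
    ((if (1 : Fin 3) = u then ((toTensor ℤ (Fin 3) (D 1)).coeff (FreeMonoid.of p * (FreeMonoid.of q * (FreeMonoid.of r * FreeMonoid.of s)))) else 0) -
      (if (1 : Fin 3) = p then ((toTensor ℤ (Fin 3) (D 1)).coeff (FreeMonoid.of q * (FreeMonoid.of r * (FreeMonoid.of s * FreeMonoid.of u)))) else 0)) +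
    ((if (2 : Fin 3) = u then ((toTensor ℤ (Fin 3) (D 2)).coeff (FreeMonoid.of p * (FreeMonoid.of q * (FreeMonoid.of r * FreeMonoid.of s)))) else 0) -
      (if (2 : Fin 3) = p then ((toTensor ℤ (Fin 3) (D 2)).coeff (FreeMonoid.of q * (FreeMonoid.of r * (FreeMonoid.of s * FreeMonoid.of u)))) else 0)) = 0 := by
  have h := congrArg (fun v => (toTensor ℤ (Fin 3) v).coeff
    (FreeMonoid.of p * (FreeMonoid.of q * (FreeMonoid.of r * (FreeMonoid.of s * FreeMonoid.of u))))) hC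
  simpa only [map_add, LieHom.map_lie, toTensor_of, LieRing.of_associative_ring_bracket, map_zero,
    MonoidAlgebra.coeff_add, MonoidAlgebra.coeff_sub, MonoidAlgebra.coeff_zero, Finsupp.add_apply,
    Finsupp.sub_apply, Finsupp.coe_zero, Pi.zero_apply, coeff_of_mul, coeff_mul_of5] using h

end LayerZeroTwo

/-- **Registered helper `helper_layerZeroTwoLieSpan`** (sub-goal of stub `stub_layerStepZeroTwo`, item
stmt-SmoothPoincare4-14595): the degree-`4` piece of the free Lie ring on three letters is spanned over `ℤ`
by the eighteen right-normed basic brackets. [folklore] -/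
theorem helper_layerZeroTwoLieSpan : ∀ u ∈ Literature.Algebra.Lie.wordGrade ℤ (FreeLieAlgebra.of ℤ : Fin 3 → FreeLieAlgebra ℤ (Fin 3)) 4, ∃ c : Fin 18 → ℤ, u = ∑ l, c l • (![⁅FreeLieAlgebra.of ℤ (0 : Fin 3), ⁅FreeLieAlgebra.of ℤ (0 : Fin 3), ⁅FreeLieAlgebra.of ℤ (0 : Fin 3), FreeLieAlgebra.of ℤ (1 : Fin 3)⁆⁆⁆,
    ⁅FreeLieAlgebra.of ℤ (0 : Fin 3), ⁅FreeLieAlgebra.of ℤ (0 : Fin 3), ⁅FreeLieAlgebra.of ℤ (0 : Fin 3), FreeLieAlgebra.of ℤ (2 : Fin 3)⁆⁆⁆,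
    ⁅FreeLieAlgebra.of ℤ (0 : Fin 3), ⁅FreeLieAlgebra.of ℤ (0 : Fin 3), ⁅FreeLieAlgebra.of ℤ (1 : Fin 3), FreeLieAlgebra.of ℤ (2 : Fin 3)⁆⁆⁆,
    ⁅FreeLieAlgebra.of ℤ (0 : Fin 3), ⁅FreeLieAlgebra.of ℤ (1 : Fin 3), ⁅FreeLieAlgebra.of ℤ (0 : Fin 3), FreeLieAlgebra.of ℤ (1 : Fin 3)⁆⁆⁆,
    ⁅FreeLieAlgebra.of ℤ (0 : Fin 3), ⁅FreeLieAlgebra.of ℤ (1 : Fin 3), ⁅FreeLieAlgebra.of ℤ (1 : Fin 3), FreeLieAlgebra.of ℤ (2 : Fin 3)⁆⁆⁆,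
    ⁅FreeLieAlgebra.of ℤ (0 : Fin 3), ⁅FreeLieAlgebra.of ℤ (2 : Fin 3), ⁅FreeLieAlgebra.of ℤ (0 : Fin 3), FreeLieAlgebra.of ℤ (1 : Fin 3)⁆⁆⁆,
    ⁅FreeLieAlgebra.of ℤ (0 : Fin 3), ⁅FreeLieAlgebra.of ℤ (2 : Fin 3), ⁅FreeLieAlgebra.of ℤ (0 : Fin 3), FreeLieAlgebra.of ℤ (2 : Fin 3)⁆⁆⁆,
    ⁅FreeLieAlgebra.of ℤ (0 : Fin 3), ⁅FreeLieAlgebra.of ℤ (2 : Fin 3), ⁅FreeLieAlgebra.of ℤ (1 : Fin 3), FreeLieAlgebra.of ℤ (2 : Fin 3)⁆⁆⁆,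
    ⁅FreeLieAlgebra.of ℤ (1 : Fin 3), ⁅FreeLieAlgebra.of ℤ (0 : Fin 3), ⁅FreeLieAlgebra.of ℤ (0 : Fin 3), FreeLieAlgebra.of ℤ (2 : Fin 3)⁆⁆⁆,
    ⁅FreeLieAlgebra.of ℤ (1 : Fin 3), ⁅FreeLieAlgebra.of ℤ (0 : Fin 3), ⁅FreeLieAlgebra.of ℤ (1 : Fin 3), FreeLieAlgebra.of ℤ (2 : Fin 3)⁆⁆⁆,
    ⁅FreeLieAlgebra.of ℤ (1 : Fin 3), ⁅FreeLieAlgebra.of ℤ (1 : Fin 3), ⁅FreeLieAlgebra.of ℤ (0 : Fin 3), FreeLieAlgebra.of ℤ (1 : Fin 3)⁆⁆⁆,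
    ⁅FreeLieAlgebra.of ℤ (1 : Fin 3), ⁅FreeLieAlgebra.of ℤ (1 : Fin 3), ⁅FreeLieAlgebra.of ℤ (1 : Fin 3), FreeLieAlgebra.of ℤ (2 : Fin 3)⁆⁆⁆,
    ⁅FreeLieAlgebra.of ℤ (1 : Fin 3), ⁅FreeLieAlgebra.of ℤ (2 : Fin 3), ⁅FreeLieAlgebra.of ℤ (0 : Fin 3), FreeLieAlgebra.of ℤ (1 : Fin 3)⁆⁆⁆,
    ⁅FreeLieAlgebra.of ℤ (1 : Fin 3), ⁅FreeLieAlgebra.of ℤ (2 : Fin 3), ⁅FreeLieAlgebra.of ℤ (0 : Fin 3), FreeLieAlgebra.of ℤ (2 : Fin 3)⁆⁆⁆,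
    ⁅FreeLieAlgebra.of ℤ (1 : Fin 3), ⁅FreeLieAlgebra.of ℤ (2 : Fin 3), ⁅FreeLieAlgebra.of ℤ (1 : Fin 3), FreeLieAlgebra.of ℤ (2 : Fin 3)⁆⁆⁆,
    ⁅FreeLieAlgebra.of ℤ (2 : Fin 3), ⁅FreeLieAlgebra.of ℤ (0 : Fin 3), ⁅FreeLieAlgebra.of ℤ (1 : Fin 3), FreeLieAlgebra.of ℤ (2 : Fin 3)⁆⁆⁆,
    ⁅FreeLieAlgebra.of ℤ (2 : Fin 3), ⁅FreeLieAlgebra.of ℤ (2 : Fin 3), ⁅FreeLieAlgebra.of ℤ (0 : Fin 3), FreeLieAlgebra.of ℤ (2 : Fin 3)⁆⁆⁆,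
    ⁅FreeLieAlgebra.of ℤ (2 : Fin 3), ⁅FreeLieAlgebra.of ℤ (2 : Fin 3), ⁅FreeLieAlgebra.of ℤ (1 : Fin 3), FreeLieAlgebra.of ℤ (2 : Fin 3)⁆⁆⁆] :
      Fin 18 → FreeLieAlgebra ℤ (Fin 3)) l :=
  fun _ hu => LayerZeroTwo.exists_coords4 hu

end Summit.SmoothPoincare4.SmoothPoincare4.Theorems.ShadowApproximation.NilpotentGenusClass

end
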